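import Literature.MathematicalPhysics.QuantumFieldTheory.Balaban1983to89.B15Claim189PinNonVacuity

/-!
# `Balaban1983to89.B15Ineq180PinAtRecord` — YM-DAG node N12 · [Balaban1989LargeFieldI] CMP **122** (1989) 175–202, (1.77)–(1.80) pp. 194–195: THE (1.80)
# DEVIATION LETTER `|U₀(∂p) − 1|` OF THE (1.89) SITUATION PINNED TO OBJECTS OF RECORD — `U₀ = U_{k,Z}(V_Λ)` (1.79) with `V_Λ` the minimiser of (1.77)
# `V_k↾_Λ ↦ A(U_{k,Z}(V_k))` for the boundary datum `V_k↾_{Z∩Λᶜ}`, TOTALISED in def-R's (2.12) idiom (a minimiser CHOSEN when one exists, the datum `V_k`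
# itself otherwise), at def-R's background of record; after the pin the displayed (1.80) READS PRINT'S (1.80) about objects of record, and at the unit
# configuration it HOLDS (the (1.80) display is neither vacuous nor refuted there)

statement-level bookkeeping over published theorems with citation tags; kernel-checked compositions of tree theorems; nothing here is a claim about the Yang–Mills
mass gap.

CITATION HEADER (lean-in-tree rule).  Source: [Balaban1989LargeFieldI] («[IV]»): (1.77) p. 194 (*"Consider the function V_k↾_Λ → A(U_{k,Z}(V_k)). (1.77)"*), Prop. 1
(1.78) p. 194 (*"there exists exactly one critical orbit of the function (1.77). An element of the orbit is a minimum of the function, and is denoted by V_Λ =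
V_Λ(V_k↾_{Z∩Λᶜ})"*; proof only in [Balaban1989LargeFieldII] pp. 358–359 — NOT asserted here), (1.79)–(1.80) p. 195 (*"Extend the function V_Λ on the whole domain
Z putting V_Λ = V_k on Z∖Λ, and define U₀ = U_{k,Z}(V_Λ). (1.79) … |U₀(∂p) − 1| < 2ε_kη² + O(1)B₃B₅M⁵exp(−δ dist(p, Λ))ε_kη² (1.80) for p∈Ω_k"*), p. 199 (*"This
configuration is equal to U₀^{ū₀} … The plaquette variables of U₀^{ū₀} satisfy the estimate (1.80)"* — plaquette deviations are gauge invariant, so the letter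
`dev0` of p29's `Setting189` is `|U₀(∂p) − 1|`); [Balaban1988Convergent] (2.12) p. 256.  Seat `pub-ymgap-dag-n12-e` (YM-PLAN Track A, HUMAN RULING D-0062;
director-ym R134 row N12 s3 «the (1.80)∕(1.89) + 𝐑′ (1.99)–(1.100) p. 201 chain»), module 8 (generation 3).  BY NAME and UNCHANGED: r12's `B15DeterminingSets`
(`IsVLambda`, `bgU0`, `fun177`, `wilsonAction4_bgU0_le`), r11's `B15Sect1Instances` (`IsVLambdaStd`, `bgU0std`, `fun177std`, `bgKZstd`, `chi175std_of_isVLambdaStd`),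
def-R's `Node00.SmallFieldChiOfRecord` (`bgOfRecord`, `UminOfRecord`, `epsOfRecord`), p29's `B15Claim189Assembly` (`Setting189`, `new189`, `dom`), `B15.Ineq180`,
module 4 `B15Claim189PinAtRecord` (`Sit189`, `D189OfRecord`, `ResidW.pinD189`), module 7 `B15Claim189PinNonVacuity` (`qsstarGIter0_one`,
`wilsonAction4_UminOfRecord_avgFamily_one`, `plaqHol_eq_one_of_wilsonAction4_eq_zero`, `one_mem_plaqSmall`, `Sit189.pinChi182`, `new189_D189OfRecord_one_iff`).

WHY THIS FILE.  Module 4 located (iv): the deviations of the intermediate configurations (1.90) ∕ (1.97) ∕ `U₀^{ū₀}` in the (1.89) situation stay LETTERS (`devV″`,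
`dev97`, `dev0`), so the displayed (1.80) `h180` of `WDisplays₁₀` speaks about a residual function of `V`.  Of the three, the (1.80) configuration IS constructible
from the tree's objects: `U₀ = U_{k,Z}(V_Λ)` is r11's `bgU0std` at Proposition 1's minimiser, and a minimiser OF RECORD is available in exactly def-R's (2.12)
idiom (`UminOfRecord`: `Classical.choose` on the solvable set, documented default off it).  This file types that pin — `VLambdaOfRecord`, `U0OfRecord`,
`dev0OfRecord`, `Sit189.pinDev0` — so that (1.80) at a pinned layer IS print's (1.80) about `U_{k,Z}(V_Λ)` at def-R's background of record (modulo the situation's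
numbers `B₃, B₅, M, δ, O(1)` and `dist(p, Λ)`), records its Proposition-1 junctions (on the solvable set `V_Λ` of record IS a minimiser; `A(U₀) ≤ A(U_{k,Z}(W))`;
(1.75) from (1.80)-smallness by r11's `chi175std_of_isVLambdaStd`), and tests it at the unit configuration: there `V_Λ ≡ 1` is admissible with `A(U_{k,Z}(1)) = 0`
(module 7's flatness), so the chosen `V_Λ` of record has `A(U₀) = 0`, `U₀` is FLAT, `|U₀(∂p) − 1| = 0`, and (1.80) HOLDS (`ε_k > 0`, `O(1)B₃B₅M⁵ ≥ 0`).  The (1.90) ∕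
(1.97) configurations need the [11] representation theorem at objects (module 4 (iv), HANDOFF (L3)) and stay letters.

WHAT THIS FILE PROVES (0 `sorry`; defs `VLambdaOfRecord`, `U0OfRecord`, `dev0OfRecord`, `Node00.Sit189.pinDev0`, `Node00.ResidW.pinD189₀`).
§1 `VLambdaOfRecord` (+ `isVLambdaStd_VLambdaOfRecord`, `VLambdaOfRecord_of_not`, `VLambdaOfRecord_eq_off` — it always extends the boundary datum), `U0OfRecord`
   (+ `U0OfRecord_eq_bgU0std`, `wilsonAction4_U0OfRecord_le` — Prop-1 junction, `chi175std_of_U0OfRecord_small` — (1.75) from (1.80)-smallness).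
§2 at unit data: `fun177std_one_eq_zero`, `isVLambdaStd_one_one`, `wilsonAction4_U0OfRecord_one`, `plaqHol_U0OfRecord_one`, `dist1_plaqHol_U0OfRecord_one`.
§3 the pin: `dev0OfRecord`, `Sit189.pinDev0` (+ `rfl` faces, `pinDev0_pinChi182_comm`), `dev0_D189OfRecord_pinDev0` (the display's letter IS `|U₀(∂q) − 1|` of record),
   **`ineq180_D189OfRecord_pinDev0_iff`** ((1.80) at the pin = print's (1.80) about objects of record), **`ineq180_pinDev0_one`** ((1.80) HOLDS at `V ≡ 1`),
   **`h180_pinDev0_one`** (the displayed binder's body at `U = (1, B′)`), `ResidW.pinD189₀` ∕ `pinD189χ₀` (+ `rfl` faces, commutation with module 2's (1.100) pin),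
   `h180_pinD189χ₀_one_of_admissible` (antecedent AND consequent of the displayed (1.80) hold at `(1, 0)` in the window: tested, not vacuous, not refuted).

HONEST FRAMING.  Count-neutral: one more data transformer in def-R's totalised-minimiser idiom + junctions by name + a variational triviality at unit data; Proposition 1
(existence ∕ uniqueness of the critical orbit, (1.78)) and (1.80) are NOT asserted; N12 NOT discharged; one finite four-torus programme at fixed `ε`, Bałaban AS PRINTED
with locators; nothing continuum ∕ ℝ⁴ ∕ OS ∕ mass gap ∕ Clay.  No `sorry`, no `axiom`, no `instance`, no `notation`.
-/

noncomputable section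

open scoped BigOperators
open MeasureTheory

namespace Literature.MathematicalPhysics.QuantumFieldTheory.Balaban1983to89

namespace B15Ineq180PinAtRecord

open DagBinding T4Continuum Node00
open B15DeterminingSets (MSField DetBackground DetSet IsMinimizer avgFamily bondsOf pts)
open B15Sect1Instances (IsVLambdaStd bgU0std bgKZstd fun177std chi175std)
open B15Claim189Assembly (Setting189 new189 dom)
open B15Claim189PinAtRecord (D189OfRecord)
open B15Claim189PinNonVacuity (qsstarGIter0_one wilsonAction4_UminOfRecord_avgFamily_one plaqHol_eq_one_of_wilsonAction4_eq_zero one_mem_plaqSmall)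
open B15 (Ineq180)
open B8Eq17ClassAkV1 (plaqsOf)
open BalabanImbrieJaffe1984to88.BIJ85Eq453GaugeField (qsstarGIter0)
open GaugeGroup (dist1)
open GaugeField (plaqHol)

/-! ## §1. `V_Λ` and `U₀ = U_{k,Z}(V_Λ)` OF RECORD (def-R's totalised-minimiser idiom) -/

section VLambda

variable {P : Params} {G : Type*} [GaugeGroup G] {av : ∀ j, Averaging P j G} (bg : DetBackground P G av) (M₁ : ℕ) (Z Λ : Set (Site P 0)) (k : ℕ)

open Classical in
/-- **`V_Λ = V_Λ(V_k↾_{Z∩Λᶜ})` OF RECORD** — Proposition 1's minimiser of (1.77) `V_k↾_Λ ↦ A(U_{k,Z}(V_k))` among the scale-`k` fields agreeing with `V_k` off the bonds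
meeting `Λ^{(k)}`, TOTALISED exactly as def-R's (2.12) solution map: a minimiser (r11's `IsVLambdaStd`) CHOSEN when one exists, and the datum `V_k` itself otherwise
(documented default: no re-minimisation).  Existence ∕ uniqueness (Prop. 1) is NOT asserted. [cite: Balaban1989LargeFieldI, (1.77) p.194, Prop. 1 (1.78) p.194] -/
def VLambdaOfRecord (Vk : GaugeField P k G) : GaugeField P k G :=
  if h : ∃ VΛ, IsVLambdaStd bg M₁ Z Λ k Vk VΛ then Classical.choose h else Vk

/-- On the solvable set `V_Λ` of record IS a minimiser of (1.77) for the datum (`Classical.choose_spec`). [cite: Balaban1989LargeFieldI, Prop. 1 (1.78) p.194] -/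
theorem isVLambdaStd_VLambdaOfRecord {Vk : GaugeField P k G} (h : ∃ VΛ, IsVLambdaStd bg M₁ Z Λ k Vk VΛ) :
    IsVLambdaStd bg M₁ Z Λ k Vk (VLambdaOfRecord bg M₁ Z Λ k Vk) := by
  unfold VLambdaOfRecord
  rw [dif_pos h]
  exact Classical.choose_spec h

/-- Off the solvable set `V_Λ` of record is the datum `V_k` (the documented default). [cite: Balaban1989LargeFieldI, Prop. 1 (1.78) p.194 (typing convention)] -/
theorem VLambdaOfRecord_of_not {Vk : GaugeField P k G} (h : ¬ ∃ VΛ, IsVLambdaStd bg M₁ Z Λ k Vk VΛ) : VLambdaOfRecord bg M₁ Z Λ k Vk = Vk := by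
  unfold VLambdaOfRecord
  rw [dif_neg h]

/-- In both branches `V_Λ` of record EXTENDS the boundary datum: `V_Λ = V_k` off the bonds meeting `Λ^{(k)}` (p. 195 *"putting V_Λ = V_k on Z∖Λ"*).
[cite: Balaban1989LargeFieldI, (1.79) p.195] -/
theorem VLambdaOfRecord_eq_off (Vk : GaugeField P k G) {b : PBond P k} (hb : b ∉ bondsOf (pts k Λ)) : VLambdaOfRecord bg M₁ Z Λ k Vk b = Vk b := by
  by_cases h : ∃ VΛ, IsVLambdaStd bg M₁ Z Λ k Vk VΛ
  · exact (isVLambdaStd_VLambdaOfRecord bg M₁ Z Λ k h).1 b hb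
  · rw [VLambdaOfRecord_of_not bg M₁ Z Λ k h]

/-- **`U₀ = U_{k,Z}(V_Λ)` OF RECORD** ((1.79) at the `V_Λ` of record: r11's `bgU0std`). [cite: Balaban1989LargeFieldI, (1.79) p.195] -/
def U0OfRecord (Vk : GaugeField P k G) : GaugeField P 0 G := bgU0std bg M₁ Z k (VLambdaOfRecord bg M₁ Z Λ k Vk)

/-- Unfolding: `U₀` of record is (1.74) `U_{k,Z}` at `V_Λ` of record. [cite: Balaban1989LargeFieldI, (1.79) p.195, (1.74) p.192] -/
theorem U0OfRecord_eq_bgKZstd (Vk : GaugeField P k G) : U0OfRecord bg M₁ Z Λ k Vk = bgKZstd bg M₁ Z k (VLambdaOfRecord bg M₁ Z Λ k Vk) := rfl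

/-- **PROPOSITION-1 JUNCTION**: on the solvable set, `A(U₀) ≤ A(U_{k,Z}(W))` for every competitor `W = V_k` off `Λ` (r11's `wilsonAction4_bgU0std_le` at the `V_Λ` of record).
[cite: Balaban1989LargeFieldI, (1.77)–(1.79) pp.194–195] -/
theorem wilsonAction4_U0OfRecord_le {Vk : GaugeField P k G} (h : ∃ VΛ, IsVLambdaStd bg M₁ Z Λ k Vk VΛ) (W : GaugeField P k G)
    (hW : ∀ b, b ∉ bondsOf (pts k Λ) → W b = Vk b) : wilsonAction4 (U0OfRecord bg M₁ Z Λ k Vk) ≤ fun177std bg M₁ Z k W :=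
  B15Sect1Instances.wilsonAction4_bgU0std_le bg M₁ Z Λ k (isVLambdaStd_VLambdaOfRecord bg M₁ Z Λ k h) W hW

/-- **(1.75) FROM (1.80)-TYPE SMALLNESS OF `U₀` OF RECORD** (print p. 195 *"U₀ belongs to the integration domain determined by … χ_k"*, the direction r11's
`chi175std_of_isVLambdaStd` records): on the solvable set, if `|U₀(∂p) − 1| < 2ε_kη²` on the plaquettes meeting `Ω^c_k`, then `χ_{k,Λ} = 1` at the datum.
[cite: Balaban1989LargeFieldI, (1.75) p.193, (1.79)–(1.80) p.195] -/
theorem chi175std_of_U0OfRecord_small (Ω : ℕ → Set (Site P 0)) {εk η : ℝ} {Vk : GaugeField P k G} (h : ∃ VΛ, IsVLambdaStd bg M₁ Z Λ k Vk VΛ)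
    (hU0 : PlaqSmallOn (plaqsOf (Ω k)ᶜ) (2 * εk * η ^ 2) (U0OfRecord bg M₁ Z Λ k Vk)) : chi175std bg M₁ Z Λ k Ω εk η Vk :=
  B15Sect1Instances.chi175std_of_isVLambdaStd bg M₁ Z Λ k Ω (isVLambdaStd_VLambdaOfRecord bg M₁ Z Λ k h) hU0

end VLambda

/-! ## §2. At UNIT DATA: `V_Λ ≡ 1` is admissible with `A(U_{k,Z}(1)) = 0`, so `U₀` of record is FLAT -/

section AtOne

variable {P : Params} {N : ℕ} [NeZero N] (av : ∀ j, Averaging P j (SU N)) {reg : Set (GaugeField P 0 (SU N))}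

/-- `A(U_{k,Z}(1)) = 0` at def-R's datum of record with `1` regular (module 7's flatness of the (2.12) solution map at unit data).
[cite: Balaban1989LargeFieldI, (1.74) p.192, (1.77) p.194; Balaban1988Convergent, (2.12) p.256] -/
theorem fun177std_one_eq_zero (h1 : (1 : GaugeField P 0 (SU N)) ∈ reg) (M₁ : ℕ) (Z : Set (Site P 0)) (k : ℕ) :
    fun177std (bgOfRecord av reg) M₁ Z k (1 : GaugeField P k (SU N)) = 0 := by
  rw [B15Sect1Instances.fun177std_eq, B15Sect1Instances.bgKZstd_apply, qsstarGIter0_one, bgOfRecord_U]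
  exact wilsonAction4_UminOfRecord_avgFamily_one av h1 _

/-- **AT THE UNIT DATUM `V_Λ ≡ 1` IS A MINIMISER OF (1.77)** (it extends `1` and has the least possible value `0`): the solvable set of Proposition 1 contains the unit
datum. [cite: Balaban1989LargeFieldI, (1.77) p.194, Prop. 1 (1.78) p.194] -/
theorem isVLambdaStd_one_one (h1 : (1 : GaugeField P 0 (SU N)) ∈ reg) (M₁ : ℕ) (Z Λ : Set (Site P 0)) (k : ℕ) :
    IsVLambdaStd (bgOfRecord av reg) M₁ Z Λ k (1 : GaugeField P k (SU N)) 1 := by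
  refine ⟨fun _ _ => rfl, fun W _ => ?_⟩
  show fun177std (bgOfRecord av reg) M₁ Z k 1 ≤ fun177std (bgOfRecord av reg) M₁ Z k W
  rw [fun177std_one_eq_zero av h1, B15Sect1Instances.fun177std_eq]
  exact wilsonAction4_nonneg _

/-- … so `U₀` of record at the unit datum has ZERO action (`A(U₀) ≤ A(U_{k,Z}(1)) = 0`). [cite: Balaban1989LargeFieldI, (1.79) p.195] -/
theorem wilsonAction4_U0OfRecord_one (h1 : (1 : GaugeField P 0 (SU N)) ∈ reg) (M₁ : ℕ) (Z Λ : Set (Site P 0)) (k : ℕ) :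
    wilsonAction4 (U0OfRecord (bgOfRecord av reg) M₁ Z Λ k (1 : GaugeField P k (SU N))) = 0 := by
  have hle := wilsonAction4_U0OfRecord_le (bgOfRecord av reg) M₁ Z Λ k ⟨1, isVLambdaStd_one_one av h1 M₁ Z Λ k⟩ 1 (fun _ _ => rfl)
  rw [fun177std_one_eq_zero av h1] at hle
  exact le_antisymm hle (wilsonAction4_nonneg _)

/-- … and is FLAT: every plaquette variable of `U₀` of record at the unit datum is `1` (`SU(N)`: zero action ⇒ `Re tr = 1` ⇒ `= 1`). [cite: Balaban1989LargeFieldI, (1.79)–(1.80) p.195] -/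
theorem plaqHol_U0OfRecord_one (h1 : (1 : GaugeField P 0 (SU N)) ∈ reg) (M₁ : ℕ) (Z Λ : Set (Site P 0)) (k : ℕ) (p : Plaq P 0) :
    plaqHol (U0OfRecord (bgOfRecord av reg) M₁ Z Λ k (1 : GaugeField P k (SU N))) p = 1 :=
  plaqHol_eq_one_of_wilsonAction4_eq_zero _ (wilsonAction4_U0OfRecord_one av h1 M₁ Z Λ k) p

/-- `|U₀(∂p) − 1| = 0` at the unit datum. [cite: Balaban1989LargeFieldI, (1.80) p.195 (bookkeeping)] -/
theorem dist1_plaqHol_U0OfRecord_one (h1 : (1 : GaugeField P 0 (SU N)) ∈ reg) (M₁ : ℕ) (Z Λ : Set (Site P 0)) (k : ℕ) (p : Plaq P 0) :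
    dist1 (plaqHol (U0OfRecord (bgOfRecord av reg) M₁ Z Λ k (1 : GaugeField P k (SU N))) p) = 0 := by
  rw [plaqHol_U0OfRecord_one av h1, GaugeGroup.dist1_one]

end AtOne

/-! ## §3. THE (1.80) LETTER PINNED at the record, the junctions, and the test at the unit configuration -/

section Dev0

variable (F : T4Family) (N : ℕ) [NeZero N]

/-- **THE (1.80) DEVIATION OF RECORD** `|U₀(∂q) − 1|` with `U₀ = U_{k,Z}(V_Λ)` of record for the boundary datum `V_k↾_{Z∩Λᶜ}` read off the multi-scale configuration `V`,
at def-R's (2.12) datum of record on the torus `K` (regularity class at level `k`, as module 4's `D189OfRecord`) and layer width `M₁`.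
[cite: Balaban1989LargeFieldI, (1.79)–(1.80) p.195] -/
def dev0OfRecord (ν : Stage7Numerics) (K : ℕ) (Z Λ : Set (Site (F.P K) 0)) (k : ℕ) : MSField (F.P K) (SU N) → Plaq (F.P K) 0 → ℝ :=
  fun V q => dist1 (plaqHol (U0OfRecord (bgOfRecord (avOfRecord F N K) {U | PlaqSmall (ν.εreg * (F.P K).eta k ^ 2) U}) ν.M₁ Z Λ k (V k)) q)

variable {F N}

/-- **THE (1.89) SITUATION WITH ITS (1.80) LETTER PINNED**: `dev0 := dev0OfRecord` at the situation's own `Z`, `Λ`, `k`; everything else unchanged.  Data, no law.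
[cite: Balaban1989LargeFieldI, (1.80) p.195] -/
def _root_.Literature.MathematicalPhysics.QuantumFieldTheory.Balaban1983to89.Node00.Sit189.pinDev0 {K : ℕ} (σ : Sit189 F N K) (ν : Stage7Numerics) : Sit189 F N K :=
  { σ with dev0 := dev0OfRecord F N ν K σ.Z σ.Λ σ.k }

variable {K : ℕ} (σ : Sit189 F N K) (ν : Stage7Numerics)

/-- The pinned letter (`rfl`). [cite: Balaban1989LargeFieldI, (1.80) p.195 (bookkeeping)] -/
theorem pinDev0_dev0 : (σ.pinDev0 ν).dev0 = dev0OfRecord F N ν K σ.Z σ.Λ σ.k := rfl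

/-- The pin keeps the chart carrier and the (1.82) letter (`rfl`; stated with `HEq` for the carrier-dependent letter). [cite: Balaban1989LargeFieldI, (1.82) p.196 (bookkeeping)] -/
theorem pinDev0_𝔤_chiP : (σ.pinDev0 ν).𝔤 = σ.𝔤 ∧ HEq (σ.pinDev0 ν).chiP σ.chiP := ⟨rfl, HEq.rfl⟩

/-- The pin keeps levels, cube sides and regions (`rfl`). [cite: Balaban1989LargeFieldI, (1.24) p.181, (1.81) p.195 (bookkeeping)] -/
theorem pinDev0_levels_regions : (σ.pinDev0 ν).h = σ.h ∧ (σ.pinDev0 ν).k₀ = σ.k₀ ∧ (σ.pinDev0 ν).k = σ.k ∧ (σ.pinDev0 ν).sh = σ.sh ∧ (σ.pinDev0 ν).sk = σ.sk ∧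
    (σ.pinDev0 ν).Ω = σ.Ω ∧ (σ.pinDev0 ν).Zpp = σ.Zpp ∧ (σ.pinDev0 ν).Z = σ.Z ∧ (σ.pinDev0 ν).Λ = σ.Λ ∧ (σ.pinDev0 ν).OmT = σ.OmT ∧ (σ.pinDev0 ν).ΩppT2 = σ.ΩppT2 :=
  ⟨rfl, rfl, rfl, rfl, rfl, rfl, rfl, rfl, rfl, rfl, rfl⟩

/-- The pin keeps numbers, cube families and the other two deviation letters (`rfl`). [cite: Balaban1989LargeFieldI, (1.80) p.195, (1.90) p.198 (bookkeeping)] -/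
theorem pinDev0_numbers_cubes : (σ.pinDev0 ν).β = σ.β ∧ (σ.pinDev0 ν).L₀ = σ.L₀ ∧ (σ.pinDev0 ν).α = σ.α ∧ (σ.pinDev0 ν).δ = σ.δ ∧ (σ.pinDev0 ν).B₃ = σ.B₃ ∧
    (σ.pinDev0 ν).B₅ = σ.B₅ ∧ (σ.pinDev0 ν).M = σ.M ∧ (σ.pinDev0 ν).O1 = σ.O1 ∧ (σ.pinDev0 ν).dist = σ.dist ∧ (σ.pinDev0 ν).Xhalf = σ.Xhalf ∧ (σ.pinDev0 ν).XH = σ.XH ∧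
    (σ.pinDev0 ν).XΩ4 = σ.XΩ4 ∧ (σ.pinDev0 ν).boxOf = σ.boxOf ∧ (σ.pinDev0 ν).devV'' = σ.devV'' ∧ (σ.pinDev0 ν).dev97 = σ.dev97 :=
  ⟨rfl, rfl, rfl, rfl, rfl, rfl, rfl, rfl, rfl, rfl, rfl, rfl, rfl, rfl, rfl⟩

/-- **The two pins of generation 3 commute** (`rfl`): module 7's χ′-pin touches `𝔤 ∕ chiP`, this pin touches `dev0`. [cite: Balaban1989LargeFieldI, (1.80) p.195, (1.82) p.196 (bookkeeping)] -/
theorem pinDev0_pinChi182_comm (δ' : ℝ) : (σ.pinChi182 δ').pinDev0 ν = (σ.pinDev0 ν).pinChi182 δ' := rfl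

end Dev0

section AtRecord

variable {F : T4Family} {N : ℕ} [NeZero N] (θ : Stage9Params F N) (P : B12.RunParams) (σ : Sit189 F N P.K)

/-- **THE DISPLAY'S LETTER AT THE PIN IS `|U₀(∂q) − 1|` OF RECORD** (`rfl`): the `dev0` of module 4's `D189OfRecord` at the dev0-pinned situation, evaluated at a pair
`U = (V, B′)`, is the plaquette deviation of `U_{k,Z}(V_Λ)` of record for the datum `V_k`. [cite: Balaban1989LargeFieldI, (1.79)–(1.80) p.195] -/
theorem dev0_D189OfRecord_pinDev0 (U : MSField (F.P P.K) (SU N) × ((j : ℕ) → VecField (F.P P.K) j σ.𝔤)) (q : Plaq (F.P P.K) 0) :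
    (D189OfRecord θ P (σ.pinDev0 θ.ν)).dev0 U q
      = dist1 (plaqHol (U0OfRecord (bgOfRecord (avOfRecord F N P.K) {U | PlaqSmall (θ.ν.εreg * (F.P P.K).eta σ.k ^ 2) U}) θ.ν.M₁ σ.Z σ.Λ σ.k (U.1 σ.k)) q) :=
  rfl

/-- **(1.80) AT THE PIN IS PRINT'S (1.80) ABOUT OBJECTS OF RECORD** (`Iff.rfl`): `|U₀(∂q) − 1| < 2ε_kη_k² + O(1)B₃B₅M⁵e^{−δ dist(q,Λ)}ε_kη_k²` with `U₀ = U_{k,Z}(V_Λ)` of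
record, `ε_k` of record, `η_k` of the torus — the numbers `B₃, B₅, M, δ, O(1)` and `dist(q, Λ)` being the situation's. [cite: Balaban1989LargeFieldI, (1.80) p.195] -/
theorem ineq180_D189OfRecord_pinDev0_iff (U : MSField (F.P P.K) (SU N) × ((j : ℕ) → VecField (F.P P.K) j σ.𝔤)) (q : Plaq (F.P P.K) 0) :
    Ineq180 ((D189OfRecord θ P (σ.pinDev0 θ.ν)).dev0 U q) (epsOfRecord θ.ν (gOfRecord₁₀ F N θ P) σ.k) ((F.P P.K).eta σ.k) σ.B₃ σ.B₅ σ.M σ.δ (σ.dist q) σ.O1 ↔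
      dist1 (plaqHol (U0OfRecord (bgOfRecord (avOfRecord F N P.K) {U | PlaqSmall (θ.ν.εreg * (F.P P.K).eta σ.k ^ 2) U}) θ.ν.M₁ σ.Z σ.Λ σ.k (U.1 σ.k)) q)
        < 2 * epsOfRecord θ.ν (gOfRecord₁₀ F N θ P) σ.k * (F.P P.K).eta σ.k ^ 2
          + σ.O1 * σ.B₃ * σ.B₅ * σ.M ^ 5 * Real.exp (-σ.δ * σ.dist q) * epsOfRecord θ.ν (gOfRecord₁₀ F N θ P) σ.k * (F.P P.K).eta σ.k ^ 2 :=
  Iff.rfl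

/-- **(1.80) HOLDS AT THE UNIT CONFIGURATION for the objects of record**: `U₀` of record at the unit datum is flat (§2), so `|U₀(∂q) − 1| = 0` and (1.80) reads
`0 < (2 + O(1)B₃B₅M⁵e^{−δ dist}) ε_kη_k²` — true for `ε_k > 0`, `εreg > 0` (so `1` is regular) and the sign input `0 ≤ O(1)B₃B₅M⁵` of module 4's display theorem.
[cite: Balaban1989LargeFieldI, (1.80) p.195 (bookkeeping witness)] -/
theorem ineq180_pinDev0_one (hreg : 0 < θ.ν.εreg) (hεk : 0 < epsOfRecord θ.ν (gOfRecord₁₀ F N θ P) σ.k) (hB : 0 ≤ σ.O1 * σ.B₃ * σ.B₅ * σ.M ^ 5)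
    (B' : (j : ℕ) → VecField (F.P P.K) j σ.𝔤) (q : Plaq (F.P P.K) 0) :
    Ineq180 ((D189OfRecord θ P (σ.pinDev0 θ.ν)).dev0 ((1 : MSField (F.P P.K) (SU N)), B') q) (epsOfRecord θ.ν (gOfRecord₁₀ F N θ P) σ.k) ((F.P P.K).eta σ.k)
      σ.B₃ σ.B₅ σ.M σ.δ (σ.dist q) σ.O1 := by
  rw [ineq180_D189OfRecord_pinDev0_iff]
  have h1 : (1 : GaugeField (F.P P.K) 0 (SU N)) ∈ {U : GaugeField (F.P P.K) 0 (SU N) | PlaqSmall (θ.ν.εreg * (F.P P.K).eta σ.k ^ 2) U} :=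
    one_mem_plaqSmall (mul_pos hreg (pow_pos (pow_pos (inv_pos.mpr (F.P P.K).cast_L_pos) σ.k) 2))
  have hη : 0 < (F.P P.K).eta σ.k ^ 2 := pow_pos (pow_pos (inv_pos.mpr (F.P P.K).cast_L_pos) σ.k) 2
  rw [show ((1 : MSField (F.P P.K) (SU N)), B').1 σ.k = (1 : GaugeField (F.P P.K) σ.k (SU N)) from rfl, dist1_plaqHol_U0OfRecord_one _ h1]
  have hA : 0 < 2 * epsOfRecord θ.ν (gOfRecord₁₀ F N θ P) σ.k * (F.P P.K).eta σ.k ^ 2 := mul_pos (mul_pos two_pos hεk) hη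
  have hC : 0 ≤ σ.O1 * σ.B₃ * σ.B₅ * σ.M ^ 5 * Real.exp (-σ.δ * σ.dist q) * epsOfRecord θ.ν (gOfRecord₁₀ F N θ P) σ.k * (F.P P.K).eta σ.k ^ 2 :=
    mul_nonneg (mul_nonneg (mul_nonneg hB (Real.exp_nonneg _)) hεk.le) hη.le
  linarith

/-- **THE DISPLAYED (1.80) BINDER'S BODY AT `U = (1, B′)`** — module 4's `h180` shape (all ℍ-domains `dom … i`, `h ≤ i ≤ k`, all their plaquettes) at the dev0-pinned
situation HOLDS at the unit configuration. [cite: Balaban1989LargeFieldI, (1.80) p.195, p.199 (bookkeeping witness)] -/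
theorem h180_pinDev0_one (hreg : 0 < θ.ν.εreg) (hεk : 0 < epsOfRecord θ.ν (gOfRecord₁₀ F N θ P) σ.k) (hB : 0 ≤ σ.O1 * σ.B₃ * σ.B₅ * σ.M ^ 5)
    (B' : (j : ℕ) → VecField (F.P P.K) j σ.𝔤) :
    ∀ i, (σ.pinDev0 θ.ν).h ≤ i → i ≤ (σ.pinDev0 θ.ν).k → ∀ q ∈ plaqsOf (dom (D189OfRecord θ P (σ.pinDev0 θ.ν)) i),
      Ineq180 ((σ.pinDev0 θ.ν).dev0 (1 : MSField (F.P P.K) (SU N)) q) (epsOfRecord θ.ν (gOfRecord₁₀ F N θ P) (σ.pinDev0 θ.ν).k) ((F.P P.K).eta (σ.pinDev0 θ.ν).k)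
        (σ.pinDev0 θ.ν).B₃ (σ.pinDev0 θ.ν).B₅ (σ.pinDev0 θ.ν).M (σ.pinDev0 θ.ν).δ ((σ.pinDev0 θ.ν).dist q) (σ.pinDev0 θ.ν).O1 :=
  fun _ _ _ q _ => ineq180_pinDev0_one θ P σ hreg hεk hB B' q

end AtRecord

/-! ## §4. The residual [IV] layer with `dev0` (and `χ′`) pinned; the (1.80) display tested at `(1, 0)` in the window -/

section Layer

variable {F : T4Family} {N : ℕ} [NeZero N]

/-- **THE RESIDUAL [IV] LAYER WITH THE (1.89) LETTERS PINNED TO THE RECORD'S OBJECTS INCLUDING THE (1.80) DEVIATION**: module 4's `ResidW.pinD189` at the dev0-pinned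
situations.  Data, no law. [cite: Balaban1989LargeFieldI, (1.89) p.198, (1.80) p.195] -/
def _root_.Literature.MathematicalPhysics.QuantumFieldTheory.Balaban1983to89.Node00.ResidW.pinD189₀ (lam : ResidW F N) (θ : Stage9Params F N)
    (σ : ∀ P : B12.RunParams, Sit189 F N P.K) : ResidW F N :=
  lam.pinD189 θ (fun P => (σ P).pinDev0 θ.ν)

/-- **… AND WITH BOTH GENERATION-3 PINS** (`χ′` of module 7 with `δ′_k` of record, then `dev0`).  Data, no law. [cite: Balaban1989LargeFieldI, (1.89) p.198, (1.80) p.195, (1.82) p.196] -/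
def _root_.Literature.MathematicalPhysics.QuantumFieldTheory.Balaban1983to89.Node00.ResidW.pinD189χ₀ (lam : ResidW F N) (θ : Stage9Params F N)
    (σ : ∀ P : B12.RunParams, Sit189 F N P.K) (p₁ : ℕ) : ResidW F N :=
  lam.pinD189 θ (fun P => ((σ P).pinChi182 (B15Claim189PinNonVacuity.deltaPrimeOfRecord F N θ P p₁ (σ P).k)).pinDev0 θ.ν)

variable (lam : ResidW F N) (θ : Stage9Params F N) (σ : ∀ P : B12.RunParams, Sit189 F N P.K) (p₁ : ℕ)

/-- The dev0-pinned layer's letters at run `P` (`rfl`). [cite: Balaban1989LargeFieldI, (1.89) p.198 (bookkeeping)] -/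
theorem pinD189₀_D189 (P : B12.RunParams) : (lam.pinD189₀ θ σ).D189 P = D189OfRecord θ P ((σ P).pinDev0 θ.ν) := rfl

/-- The doubly-lettered pin's letters at run `P` (`rfl`). [cite: Balaban1989LargeFieldI, (1.89) p.198 (bookkeeping)] -/
theorem pinD189χ₀_D189 (P : B12.RunParams) :
    (lam.pinD189χ₀ θ σ p₁).D189 P = D189OfRecord θ P (((σ P).pinChi182 (B15Claim189PinNonVacuity.deltaPrimeOfRecord F N θ P p₁ (σ P).k)).pinDev0 θ.ν) := rfl

/-- Both pins keep the step selector, the Proposition-1 carrier and the (1.100) data (`rfl`). [cite: Balaban1989LargeFieldI, (0.2) p.176, Prop. 1 p.194, (1.100) p.201 (bookkeeping)] -/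
theorem pinD189χ₀_kSel_LF_D1100 : (lam.pinD189χ₀ θ σ p₁).kSel = lam.kSel ∧ (lam.pinD189χ₀ θ σ p₁).LF = lam.LF ∧ (lam.pinD189χ₀ θ σ p₁).D1100 = lam.D1100 ∧
    (lam.pinD189₀ θ σ).kSel = lam.kSel ∧ (lam.pinD189₀ θ σ).LF = lam.LF ∧ (lam.pinD189₀ θ σ).D1100 = lam.D1100 :=
  ⟨rfl, rfl, rfl, rfl, rfl, rfl⟩

/-- Both pins commute with module 2's (1.100) pin (`rfl`). [cite: Balaban1989LargeFieldI, (1.89) p.198, (1.100) p.201 (bookkeeping)] -/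
theorem pinD189χ₀_pinRPrime_comm : (lam.pinD189χ₀ θ σ p₁).pinRPrime θ = (lam.pinRPrime θ).pinD189χ₀ θ σ p₁ ∧ (lam.pinD189₀ θ σ).pinRPrime θ = (lam.pinRPrime θ).pinD189₀ θ σ :=
  ⟨rfl, rfl⟩

variable {θ} in
/-- **IN THE WINDOW, AT ADMISSIBLE PARAMETERS, THE DISPLAYED (1.80) IS TESTED AT `(1, 0)`: its ANTECEDENT holds (module 7: all four remaining functions at the unit
configuration, `δ′_k > 0`) AND its CONSEQUENT holds (this file: `U₀` of record flat)** — for a run whose history lies in `]0, γ]` up to `n` (`γ < 1`), `A₁ > 0`, a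
situation with `σ.h ≤ σ.k ≤ n` and the sign input `0 ≤ O(1)B₃B₅M⁵`.  So at the doubly-lettered pin the (1.80) display is neither vacuous nor refuted at the unit
configuration. [cite: Balaban1989LargeFieldI, (1.80) p.195, (1.89) p.198, (1.82) p.196; Balaban1988Convergent, (2.4) p.255, (2.12) p.256] -/
theorem h180_pinD189χ₀_one_of_admissible (hθ : θ.Admissible) (hγ1 : θ.γ < 1) (hA₁ : 0 < θ.A₁) (P : B12.RunParams) {n : ℕ}
    (hI : Step.InInterval θ.γ n (gOfRecord₁₀ F N θ P)) (hhk : (σ P).h ≤ (σ P).k) (hkn : (σ P).k ≤ n) (hB : 0 ≤ (σ P).O1 * (σ P).B₃ * (σ P).B₅ * (σ P).M ^ 5) :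
    new189 ((lam.pinD189χ₀ θ σ p₁).D189 P) ((1 : MSField (F.P P.K) (SU N)), fun _ _ => (0 : EuclideanSpace ℝ (Fin (N ^ 2 - 1)))) ∧
    ∀ i, ((lam.pinD189χ₀ θ σ p₁).D189 P).h ≤ i → i ≤ ((lam.pinD189χ₀ θ σ p₁).D189 P).k → ∀ q ∈ plaqsOf (dom ((lam.pinD189χ₀ θ σ p₁).D189 P) i),
      Ineq180 (((lam.pinD189χ₀ θ σ p₁).D189 P).dev0 ((1 : MSField (F.P P.K) (SU N)), fun _ _ => (0 : EuclideanSpace ℝ (Fin (N ^ 2 - 1)))) q)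
        (((lam.pinD189χ₀ θ σ p₁).D189 P).ε ((lam.pinD189χ₀ θ σ p₁).D189 P).k) ((lam.pinD189χ₀ θ σ p₁).D189 P).η ((lam.pinD189χ₀ θ σ p₁).D189 P).B₃
        ((lam.pinD189χ₀ θ σ p₁).D189 P).B₅ ((lam.pinD189χ₀ θ σ p₁).D189 P).M ((lam.pinD189χ₀ θ σ p₁).D189 P).δ (((lam.pinD189χ₀ θ σ p₁).D189 P).dist q)
        ((lam.pinD189χ₀ θ σ p₁).D189 P).O1 := by
  have hreg : 0 < θ.ν.εreg := hθ.1.1.2.2.1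
  have hεk : 0 < epsOfRecord θ.ν (gOfRecord₁₀ F N θ P) (σ P).k := B15Claim189FlowAtRecord.epsOfRecord₁₀_pos_of_admissible hθ hγ1 P hI (σ P).k hkn
  have hεh : 0 < epsOfRecord θ.ν (gOfRecord₁₀ F N θ P) (σ P).h := B15Claim189FlowAtRecord.epsOfRecord₁₀_pos_of_admissible hθ hγ1 P hI (σ P).h (hhk.trans hkn)
  have hδ : 0 < B15Claim189PinNonVacuity.deltaPrimeOfRecord F N θ P p₁ (σ P).k := B15Claim189PinNonVacuity.deltaPrimeOfRecord_pos_of_inInterval θ P p₁ hA₁ hγ1 hI hkn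
  refine ⟨?_, fun _ _ _ q _ =>
    ineq180_pinDev0_one θ P ((σ P).pinChi182 (B15Claim189PinNonVacuity.deltaPrimeOfRecord F N θ P p₁ (σ P).k)) hreg hεk hB
      (fun _ _ => (0 : EuclideanSpace ℝ (Fin (N ^ 2 - 1)))) q⟩
  exact (B15Claim189PinNonVacuity.new189_D189OfRecord_one_iff θ P
      (((σ P).pinChi182 (B15Claim189PinNonVacuity.deltaPrimeOfRecord F N θ P p₁ (σ P).k)).pinDev0 θ.ν) hhk hreg hεk hεh _).2
    (B15Claim189PinNonVacuity.chiP_pinChi182_zero (σ P) _ hδ)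

end Layer

end B15Ineq180PinAtRecord

end Literature.MathematicalPhysics.QuantumFieldTheory.Balaban1983to89

end
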